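import Literature.NumberTheory.Automorphic.ArchTorusOrbitalFunctionAtPoint     -- ★ (this road, global half): generic `IsCanonical.classOrbitalIntegral_mk_eq_integral_conj_of_isCompact`; ★ (V8)-orb fibre book-keeping; ★ part II
import Literature.NumberTheory.Automorphic.ArchLocalTorusOrbitalContinuity     -- ★ (a5) (p839258, F0P3a-p06): `continuousOn_integral_comp_conj_circleDiagonal` — the torus function is continuous on `T_reg`
import HarnessLib

/-!
# The per-place stable orbital integral `Φ^st_w(diag z, a)` at a regular circle-torus point of `G_w = U(σ_w diag α)(ℂ)`: finite sum, `S_N`-average with the factor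
# `(p_w!(N−p_w)!)⁻¹`, explicit group integrals for canonical families, and continuity on `T_reg` from the torus function (Rogawski 1990 §4.1 (4.1.1) p. 39, §8.2 Prop. 8.2.1 p. 118)

Topic `NumberTheory/Automorphic`; namespace `Literature.NumberTheory.Automorphic.UnitaryGroup`.  THEOREMS ONLY (no definition, no instance, no notation, no named fact, no `sorry`).
Cell `pub/hodgecm-mathlib`, ENGINE T1 (crux H413 = `stmt-HodgeConjecture-24833`); floor-1 preparation, count-neutral, under books rows #88 (ST-∞) ∕ #111 (S-d): road D2′, brick
**«(V2′)↔(V8)-orb JUNCTION», PER-PLACE half** (LEAD WORD T7-63 + (V7) ruling «per place first»; author F0P3a-p02 (g9)); sequel of ★ `ArchTorusOrbitalFunctionAtPoint` (global half) over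
★ (V8)-reg part II `ArchLocalRegularTorusClasses` (p838737: `conjClasses_stable_circleDiagonal_eq_range`, `mk_circleDiagonal_eq_mk_iff_image_eq_image`, `ncard_… = C(N, p_w)`).
Carrier (token-exact): ★ `stableOrbitalIntegralRel (G := archLocal L N (diagonal α) w) (IsStablyConj (starRingEnd ℂ) ((diagonal α).map w.1.embedding)) m a ⟨circleDiagonal N z, _⟩` —
LETTER #4 §5's per-place stable orbital integral `Φ^st_w` (`Rogawski1990/LocalTransfer.lean` :106), as read by ★ `ArchLocalStableConjDefinite` at the definite places.

WHAT IS PROVED (`α_i ≠ 0`, `(σ_w α_i).im = 0`, `z` injective = regular).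
* §1 `isCompact_centralizer_circleDiagonal` (`Z(diag z) = T_w` compact), `isRegularElt_circleDiagonal_iff` (`diag z` regular in `GL_N(ℂ)` iff `z` injective), `isRegularElt_out_mk_circleDiagonal`.
* §2 (ANY family `m`, ANY `a`): `card_filter_mk_circleDiagonal_eq` ∕ **`card_filter_mk_circleDiagonal_eq_factorial`** (the fibres of `σ ↦ ⟦diag(z∘σ)⟧` on `S_N` all have size
  `p_w!(N−p_w)!`, `p_w = #{i ∣ re σ_w(α_i) > 0}`), **`stableOrbitalIntegralRel_circleDiagonal_eq_sum`** (`Φ^st_w(diag z, a) = Σ_{q ∈ univ.image (σ ↦ ⟦diag(z∘σ)⟧)} Φ(q, a)`),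
  **`stableOrbitalIntegralRel_circleDiagonal_eq_inv_mul_sum_classOrbitalIntegral`** (`= (p_w!(N−p_w)!)⁻¹ Σ_{σ ∈ S_N} Φ(⟦diag(z∘σ)⟧, a)`).
* §3 (`m` canonical for `(P, ν)`, `ν` the Haar measure of `G_w`, `P` at the torus representatives — e.g. `P = IsRegularElt ∘ val` by §1; `a` continuous):
  **`classOrbitalIntegral_mk_circleDiagonal_eq_integral_conj`** (`Φ(⟦diag z⟧, a) = ∫_{G_w} a(g·diag z·g⁻¹) dν` — ★ (V2)-Q's torus term at mass one),
  **`stableOrbitalIntegralRel_circleDiagonal_eq_inv_mul_sum_integral_conj`** (`Φ^st_w(diag z, a) = (p_w!(N−p_w)!)⁻¹ Σ_{σ} ∫_{G_w} a(g·diag(z∘σ)·g⁻¹) dν`; print at `U(2,1)`: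
  `Φ(γ,f) + Φ(γ₁,f) + Φ(γ₂,f) = ½ Σ_{σ ∈ S₃} ∫ f(g γ_σ g⁻¹) dg`), and **`continuousOn_stableOrbitalIntegralRel_circleDiagonal_of_continuousOn`** — `z ↦ Φ^st_w(diag z, a)` is continuous on
  `{z ∣ z injective}` as soon as the torus function `z ↦ ∫_{G_w} a(g·diag z·g⁻¹) dν` is (hypothesis `hF` = F0P3a-p06 (g9)'s (a5) head `continuousOn_integral_comp_conj_circleDiagonal` for
  `a ∈ C_c(G_w)`, ROAD-Sd (V2)-glob `ArchLocalTorusOrbitalContinuity`, ★ p839258) and the UNCONDITIONAL corollary **`continuousOn_stableOrbitalIntegralRel_circleDiagonal`**: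
  `Φ^st_w(diag z, a)` is continuous on `T_reg` for every `a ∈ C_c(G_w)` — the (L-cont) input for the stable orbital integral, in any signature.
JUNK AUDIT: `hz` necessary throughout; in §3 `P` is kept GENERIC with the hypothesis at the torus representatives (`hP`), discharged for `P = IsRegularElt ∘ val` by §1.  HONEST LABEL:
HC_CM is proved only modulo the printed citations until rung 0 closes; this file is measure-theoretic book-keeping (count-neutral floor-1 preparation) and pays nothing by itself.

## References
* [Rogawski1990] J. D. Rogawski, *Automorphic Representations of Unitary Groups in Three Variables*, Ann. of Math. Stud. 123 (1990): §3.1 p. 19, §3.7 Prop. 3.7.1 pp. 29–30, §4.1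
  (4.1.1) p. 39, §4.9 p. 54, §8.2 Prop. 8.2.1 p. 118.
* [Folland1995] G. B. Folland, *A Course in Abstract Harmonic Analysis* (1995), §2.6 (2.52).
* [Shelstad1979] D. Shelstad, *Characters and inner forms of a quasi-split group over ℝ*, Compositio Math. 39 (1979), §4.
* [BrockerTomDieck1985] Th. Bröcker, T. tom Dieck, *Representations of Compact Lie Groups*, GTM 98 (1985), Ch. IV (3.1)–(3.2).
-/

set_option autoImplicit false

noncomputable section

open MeasureTheory Measure Set Matrix Equiv NumberField NumberField.InfinitePlace TopologicalSpace Literature.MeasureTheory.Group Polynomial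
open scoped MatrixGroups ENNReal NNReal

namespace Literature.NumberTheory.Automorphic

namespace UnitaryGroup

open Literature.LinearAlgebra.Matrix Literature.NumberTheory.Rogawski1990

section Place

variable (L : Type) [Field L] (N : ℕ) (α : Fin N → L) (w : {w : InfinitePlace L // IsComplex w})

/-! ## §1 The circle torus point `diag(z)` in `G_w = archLocal L N (diagonal α) w`: compact centraliser, regularity -/

/-- **The centraliser of a regular circle-torus point is COMPACT** (it is the circle torus `T_w`, ★ `centralizer_circleDiagonal_eq_subgroupOf`; ★ `isCompact_circleTorus`).
[cite: Rogawski1990, §3.1 p. 19; §8.2 Prop. 8.2.1 p. 118] [cite: BrockerTomDieck1985, Ch. IV (3.1)] -/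
theorem isCompact_centralizer_circleDiagonal (hα : ∀ i, α i ≠ 0) {z : Fin N → Circle} (hz : Function.Injective z) :
    IsCompact ((Subgroup.centralizer ({(⟨circleDiagonal N z, circleDiagonal_mem_archLocal_diagonal L N α w z⟩ : archLocal L N (diagonal α) w)} :
      Set (archLocal L N (diagonal α) w))) : Set (archLocal L N (diagonal α) w)) := by
  rw [centralizer_circleDiagonal_eq_subgroupOf L N α w hα hz]
  exact isCompact_circleTorus L N α w

omit w in
/-- `diag(z)` is a REGULAR element of `GL_N(ℂ)` iff `z` is injective (`χ_{diag z} = ∏ (X − z_i)`, Mathlib `charpoly_diagonal` ∕ `separable_prod_X_sub_C_iff`).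
[cite: Rogawski1990, §3.1 p. 19] -/
theorem isRegularElt_circleDiagonal_iff (z : Fin N → Circle) : IsRegularElt (circleDiagonal N z) ↔ Function.Injective z := by
  rw [isRegularElt_iff, coe_circleDiagonal, Matrix.charpoly_diagonal, Polynomial.separable_prod_X_sub_C_iff]
  exact ⟨fun h i j hij => h (congrArg Subtype.val hij), fun h i j hij => h (Circle.ext hij)⟩

/-- The class representative `out ⟦diag z⟧` in `G_w` is regular for injective `z` (★ `isRegularElt_of_isConj`). [cite: Rogawski1990, §3.1 p. 19] -/
theorem isRegularElt_out_mk_circleDiagonal {z : Fin N → Circle} (hz : Function.Injective z) :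
    IsRegularElt ((Quotient.out (ConjClasses.mk (⟨circleDiagonal N z, circleDiagonal_mem_archLocal_diagonal L N α w z⟩ : archLocal L N (diagonal α) w)) :
      archLocal L N (diagonal α) w) : GL (Fin N) ℂ) := by
  have hc : IsConj (⟨circleDiagonal N z, circleDiagonal_mem_archLocal_diagonal L N α w z⟩ : archLocal L N (diagonal α) w)
      (Quotient.out (ConjClasses.mk (⟨circleDiagonal N z, circleDiagonal_mem_archLocal_diagonal L N α w z⟩ : archLocal L N (diagonal α) w))) :=
    ConjClasses.mk_eq_mk_iff_isConj.mp (Quotient.out_eq _).symm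
  exact isRegularElt_of_isConj ((archLocal L N (diagonal α) w).subtype.map_isConj hc) ((isRegularElt_circleDiagonal_iff N z).mpr hz)

/-! ## §2 `Φ^st_w(diag z, a)` — the per-place stable orbital integral at a regular torus point — as a finite sum and as an average over `S_N` (any `m`, any `a`) -/

open scoped Classical in
/-- **All fibres of `σ ↦ ⟦diag(z ∘ σ)⟧` on `S_N` have the same size** (`σ ↦ σ₀σ`; ★ part II `mk_circleDiagonal_eq_mk_iff_image_eq_image`). [cite: Rogawski1990, §3.7 Prop. 3.7.1 pp. 29–30] -/
theorem card_filter_mk_circleDiagonal_eq (hα : ∀ i, α i ≠ 0) (hreal : ∀ i, (w.1.embedding (α i)).im = 0) {z : Fin N → Circle}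
    (hz : Function.Injective z) (σ₀ : Perm (Fin N)) :
    (Finset.univ.filter fun σ : Perm (Fin N) =>
        ConjClasses.mk (⟨circleDiagonal N (z ∘ σ), circleDiagonal_mem_archLocal_diagonal L N α w (z ∘ σ)⟩ : archLocal L N (diagonal α) w) =
          ConjClasses.mk (⟨circleDiagonal N (z ∘ σ₀), circleDiagonal_mem_archLocal_diagonal L N α w (z ∘ σ₀)⟩ : archLocal L N (diagonal α) w)).card =
      (Finset.univ.filter fun κ : Perm (Fin N) =>
        ConjClasses.mk (⟨circleDiagonal N (z ∘ κ), circleDiagonal_mem_archLocal_diagonal L N α w (z ∘ κ)⟩ : archLocal L N (diagonal α) w) =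
          ConjClasses.mk (⟨circleDiagonal N (z ∘ (1 : Perm (Fin N))), circleDiagonal_mem_archLocal_diagonal L N α w (z ∘ (1 : Perm (Fin N)))⟩ :
            archLocal L N (diagonal α) w)).card := by
  have hU := mem_archLocal_diagonal_iff_mem_unitaryGroupOfForm L N α w hreal
  have he := re_embedding_ne_zero L N α w hα hreal
  -- `⟦diag(z ∘ σ₀κ)⟧ = ⟦diag(z ∘ σ₀)⟧ ↔ ⟦diag(z ∘ κ)⟧ = ⟦diag(z ∘ 1)⟧`
  have hmul : ∀ κ : Perm (Fin N),
      ConjClasses.mk (⟨circleDiagonal N (z ∘ ⇑(σ₀ * κ)), circleDiagonal_mem_archLocal_diagonal L N α w (z ∘ ⇑(σ₀ * κ))⟩ : archLocal L N (diagonal α) w) =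
          ConjClasses.mk (⟨circleDiagonal N (z ∘ σ₀), circleDiagonal_mem_archLocal_diagonal L N α w (z ∘ σ₀)⟩ : archLocal L N (diagonal α) w) ↔
        ConjClasses.mk (⟨circleDiagonal N (z ∘ κ), circleDiagonal_mem_archLocal_diagonal L N α w (z ∘ κ)⟩ : archLocal L N (diagonal α) w) =
          ConjClasses.mk (⟨circleDiagonal N (z ∘ (1 : Perm (Fin N))), circleDiagonal_mem_archLocal_diagonal L N α w (z ∘ (1 : Perm (Fin N)))⟩ :
            archLocal L N (diagonal α) w) := fun κ => by
    rw [mk_circleDiagonal_eq_mk_iff_image_eq_image N _ _ hU he hz (σ₀ * κ) σ₀, mk_circleDiagonal_eq_mk_iff_image_eq_image N _ _ hU he hz κ 1,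
      Perm.coe_mul, ← Finset.image_image, Perm.coe_one, Finset.image_id]
    exact (Finset.image_injective σ₀.injective).eq_iff
  have hset : (Finset.univ.filter fun σ : Perm (Fin N) =>
        ConjClasses.mk (⟨circleDiagonal N (z ∘ σ), circleDiagonal_mem_archLocal_diagonal L N α w (z ∘ σ)⟩ : archLocal L N (diagonal α) w) =
          ConjClasses.mk (⟨circleDiagonal N (z ∘ σ₀), circleDiagonal_mem_archLocal_diagonal L N α w (z ∘ σ₀)⟩ : archLocal L N (diagonal α) w)) =
      (Finset.univ.filter fun κ : Perm (Fin N) =>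
        ConjClasses.mk (⟨circleDiagonal N (z ∘ κ), circleDiagonal_mem_archLocal_diagonal L N α w (z ∘ κ)⟩ : archLocal L N (diagonal α) w) =
          ConjClasses.mk (⟨circleDiagonal N (z ∘ (1 : Perm (Fin N))), circleDiagonal_mem_archLocal_diagonal L N α w (z ∘ (1 : Perm (Fin N)))⟩ :
            archLocal L N (diagonal α) w)).image fun κ => σ₀ * κ := by
    ext σ
    simp only [Finset.mem_filter, Finset.mem_image, Finset.mem_univ, true_and]
    constructor
    · intro h
      refine ⟨σ₀⁻¹ * σ, (hmul _).mp ?_, mul_inv_cancel_left σ₀ σ⟩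
      have e : σ₀ * (σ₀⁻¹ * σ) = σ := mul_inv_cancel_left σ₀ σ
      rw [e]; exact h
    · rintro ⟨κ, hκ, rfl⟩
      exact (hmul κ).mpr hκ
  rw [hset, Finset.card_image_of_injective _ (mul_right_injective σ₀)]

open scoped Classical in
/-- **The common fibre size is `p_w! (N − p_w)!`**, `p_w = #{i ∣ re σ_w(α_i) > 0}` (`K · C(N, p_w) = N!` by ★ part II `ncard_conjClasses_stable_circleDiagonal`).
[cite: Rogawski1990, §3.7 Prop. 3.7.1 pp. 29–30] [cite: BrockerTomDieck1985, Ch. IV (3.2)] -/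
theorem card_filter_mk_circleDiagonal_eq_factorial (hα : ∀ i, α i ≠ 0) (hreal : ∀ i, (w.1.embedding (α i)).im = 0) {z : Fin N → Circle}
    (hz : Function.Injective z) (σ₀ : Perm (Fin N)) :
    (Finset.univ.filter fun σ : Perm (Fin N) =>
        ConjClasses.mk (⟨circleDiagonal N (z ∘ σ), circleDiagonal_mem_archLocal_diagonal L N α w (z ∘ σ)⟩ : archLocal L N (diagonal α) w) =
          ConjClasses.mk (⟨circleDiagonal N (z ∘ σ₀), circleDiagonal_mem_archLocal_diagonal L N α w (z ∘ σ₀)⟩ : archLocal L N (diagonal α) w)).card =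
      (Finset.univ.filter fun i => 0 < (w.1.embedding (α i)).re).card.factorial * (N - (Finset.univ.filter fun i => 0 < (w.1.embedding (α i)).re).card).factorial := by
  have hfib := fun σ₁ : Perm (Fin N) => card_filter_mk_circleDiagonal_eq L N α w hα hreal hz σ₁
  rw [hfib σ₀]
  have hKM := card_fiber_mul_card_image_eq_card
    (fun σ : Perm (Fin N) => ConjClasses.mk (⟨circleDiagonal N (z ∘ σ), circleDiagonal_mem_archLocal_diagonal L N α w (z ∘ σ)⟩ : archLocal L N (diagonal α) w)) _ hfib
  have hcardimg : (Finset.univ.image fun σ : Perm (Fin N) =>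
      ConjClasses.mk (⟨circleDiagonal N (z ∘ σ), circleDiagonal_mem_archLocal_diagonal L N α w (z ∘ σ)⟩ : archLocal L N (diagonal α) w)).card =
        Nat.choose N (Finset.univ.filter fun i => 0 < (w.1.embedding (α i)).re).card := by
    have h := ncard_conjClasses_stable_circleDiagonal L N α w hα hreal hz
    rwa [conjClasses_stable_circleDiagonal_eq_range L N α w hα hreal hz, ← Set.image_univ, ← Finset.coe_univ, ← Finset.coe_image,
      Set.ncard_coe_finset] at h
  rw [hcardimg, Fintype.card_perm, Fintype.card_fin] at hKM
  have hle : (Finset.univ.filter fun i => 0 < (w.1.embedding (α i)).re).card ≤ N :=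
    (Finset.card_filter_le _ _).trans (by rw [Finset.card_univ, Fintype.card_fin])
  have hprod := Nat.choose_mul_factorial_mul_factorial hle
  have hpos : 0 < Nat.choose N (Finset.univ.filter fun i => 0 < (w.1.embedding (α i)).re).card := Nat.choose_pos hle
  refine Nat.eq_of_mul_eq_mul_right hpos ?_
  rw [hKM, ← hprod]
  ring

variable [∀ g : archLocal L N (diagonal α) w, MeasurableSpace (archLocal L N (diagonal α) w ⧸ Subgroup.centralizer ({g} : Set (archLocal L N (diagonal α) w)))]

open scoped Classical in
/-- **`Φ^st_w(diag z, a) = Σ_{q ∈ univ.image (σ ↦ ⟦diag(z∘σ)⟧)} Φ(q, a)`** — ★ `stableOrbitalIntegralRel (IsStablyConj ⋆ (σ_w diag α))` (LETTER #4 §5's per-place currency) at a regular torus point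
is a finite sum over the classes of the permuted torus points (★ part II `conjClasses_stable_circleDiagonal_eq_range` + ★ `stableOrbitalIntegralRel_eq_sum`); any family `m`, any `a`.
[cite: Rogawski1990, §4.1 (4.1.1) p. 39; §8.2 Prop. 8.2.1 p. 118] -/
theorem stableOrbitalIntegralRel_circleDiagonal_eq_sum (hα : ∀ i, α i ≠ 0) (hreal : ∀ i, (w.1.embedding (α i)).im = 0) {z : Fin N → Circle}
    (hz : Function.Injective z) (m : OrbitalMeasureFamily (archLocal L N (diagonal α) w)) (a : archLocal L N (diagonal α) w → ℂ) :
    stableOrbitalIntegralRel (G := archLocal L N (diagonal α) w) (IsStablyConj (starRingEnd ℂ) ((diagonal α).map w.1.embedding)) m a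
        ⟨circleDiagonal N z, circleDiagonal_mem_archLocal_diagonal L N α w z⟩ =
      ∑ q ∈ Finset.univ.image (fun σ : Perm (Fin N) =>
          ConjClasses.mk (⟨circleDiagonal N (z ∘ σ), circleDiagonal_mem_archLocal_diagonal L N α w (z ∘ σ)⟩ : archLocal L N (diagonal α) w)),
        classOrbitalIntegral m a q := by
  rw [stableOrbitalIntegralRel_eq_sum m a (finite_conjClasses_stable_circleDiagonal L N α w hα hreal hz)]
  refine Finset.sum_congr ?_ fun _ _ => rfl
  apply Finset.coe_injective
  rw [Set.Finite.coe_toFinset]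
  exact (conjClasses_stable_circleDiagonal_eq_range L N α w hα hreal hz).trans (by rw [Finset.coe_image, Finset.coe_univ, Set.image_univ])

open scoped Classical in
/-- **`Φ^st_w(diag z, a) = (p_w!(N−p_w)!)⁻¹ · Σ_{σ ∈ S_N} Φ(⟦diag(z∘σ)⟧, a)`** — per-place twin of ★ (V8)-orb (r2′): the stable orbital integral at a regular torus point as a symmetric
average over the full Weyl orbit (any `m`, any `a`; `= ½ Σ_{σ ∈ S₃}` at signature `(2,1)`, `= (1∕6) Σ_{σ ∈ S₃}` at a definite place).
[cite: Rogawski1990, §4.1 (4.1.1) p. 39; §8.2 Prop. 8.2.1 p. 118; §3.7 Prop. 3.7.1 pp. 29–30] -/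
theorem stableOrbitalIntegralRel_circleDiagonal_eq_inv_mul_sum_classOrbitalIntegral (hα : ∀ i, α i ≠ 0) (hreal : ∀ i, (w.1.embedding (α i)).im = 0)
    {z : Fin N → Circle} (hz : Function.Injective z) (m : OrbitalMeasureFamily (archLocal L N (diagonal α) w)) (a : archLocal L N (diagonal α) w → ℂ) :
    stableOrbitalIntegralRel (G := archLocal L N (diagonal α) w) (IsStablyConj (starRingEnd ℂ) ((diagonal α).map w.1.embedding)) m a
        ⟨circleDiagonal N z, circleDiagonal_mem_archLocal_diagonal L N α w z⟩ =
      (((Finset.univ.filter fun i => 0 < (w.1.embedding (α i)).re).card.factorial *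
          (N - (Finset.univ.filter fun i => 0 < (w.1.embedding (α i)).re).card).factorial : ℕ) : ℂ)⁻¹ *
        ∑ σ : Perm (Fin N), classOrbitalIntegral m a
          (ConjClasses.mk (⟨circleDiagonal N (z ∘ σ), circleDiagonal_mem_archLocal_diagonal L N α w (z ∘ σ)⟩ : archLocal L N (diagonal α) w)) := by
  have hsum := sum_eq_card_fiber_smul_sum_image
    (fun σ : Perm (Fin N) => ConjClasses.mk (⟨circleDiagonal N (z ∘ σ), circleDiagonal_mem_archLocal_diagonal L N α w (z ∘ σ)⟩ : archLocal L N (diagonal α) w))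
    (classOrbitalIntegral m a) _ (card_filter_mk_circleDiagonal_eq_factorial L N α w hα hreal hz)
  beta_reduce at hsum
  have hKpos : (((Finset.univ.filter fun i => 0 < (w.1.embedding (α i)).re).card.factorial *
      (N - (Finset.univ.filter fun i => 0 < (w.1.embedding (α i)).re).card).factorial : ℕ) : ℂ) ≠ 0 := by
    rw [Nat.cast_ne_zero]; exact (Nat.mul_pos (Nat.factorial_pos _) (Nat.factorial_pos _)).ne'
  rw [hsum, nsmul_eq_mul, ← mul_assoc, inv_mul_cancel₀ hKpos, one_mul, stableOrbitalIntegralRel_circleDiagonal_eq_sum L N α w hα hreal hz m a]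

/-! ## §3 Canonical families on `G_w`: honest group integrals and the continuity of `Φ^st_w` on `T_reg` -/

variable [LocallyCompactSpace (archLocal L N (diagonal α) w)] [SecondCountableTopology (archLocal L N (diagonal α) w)]
  [MeasurableSpace (archLocal L N (diagonal α) w)] [BorelSpace (archLocal L N (diagonal α) w)]
  [∀ g : archLocal L N (diagonal α) w, BorelSpace (archLocal L N (diagonal α) w ⧸ Subgroup.centralizer ({g} : Set (archLocal L N (diagonal α) w)))]

/-- **`Φ(⟦diag z⟧, a) = ∫_{G_w} a(g · diag z · g⁻¹) dν(g)`** for a family `m` canonical for `(P, ν)` with `P (out ⟦diag z⟧)`, `z` injective, `a` continuous (generic §1 of ★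
`ArchTorusOrbitalFunctionAtPoint` at the compact circle torus).  With ★ (V2)-Q `integral_descConj_circleDiagonal_eq_inv_smul` at torus mass one this is the (V2′) fixed-quotient
term `F_a(z)` — so ★ (a5) `continuousOn_integral_comp_conj_circleDiagonal` (F0P3a-p06) speaks about the same function. [cite: Rogawski1990, §4.9 p. 54; §8.2 Prop. 8.2.1 p. 118]
[cite: Folland1995, §2.6 (2.52)] -/
theorem classOrbitalIntegral_mk_circleDiagonal_eq_integral_conj (hα : ∀ i, α i ≠ 0) {P : archLocal L N (diagonal α) w → Prop}
    {ν : Measure (archLocal L N (diagonal α) w)} [ν.IsHaarMeasure] [ν.IsMulRightInvariant] {m : OrbitalMeasureFamily (archLocal L N (diagonal α) w)}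
    (hm : m.IsCanonical P ν) {z : Fin N → Circle} (hz : Function.Injective z)
    (hP : P (Quotient.out (ConjClasses.mk (⟨circleDiagonal N z, circleDiagonal_mem_archLocal_diagonal L N α w z⟩ : archLocal L N (diagonal α) w))))
    (a : archLocal L N (diagonal α) w → ℂ) (ha : Continuous a) :
    classOrbitalIntegral m a (ConjClasses.mk (⟨circleDiagonal N z, circleDiagonal_mem_archLocal_diagonal L N α w z⟩ : archLocal L N (diagonal α) w)) =
      ∫ g, a (g * ⟨circleDiagonal N z, circleDiagonal_mem_archLocal_diagonal L N α w z⟩ * g⁻¹) ∂ν :=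
  hm.classOrbitalIntegral_mk_eq_integral_conj_of_isCompact _ hP (isCompact_centralizer_circleDiagonal L N α w hα hz) a ha

open scoped Classical in
/-- **`Φ^st_w(diag z, a) = (p_w!(N−p_w)!)⁻¹ · Σ_{σ ∈ S_N} ∫_{G_w} a(g · diag(z∘σ) · g⁻¹) dν(g)`** — the per-place stable orbital integral at a regular torus point as an explicit average of
group integrals (canonical `m` on the classes `⟦diag(z∘σ)⟧`, continuous `a`).  Print at `U(2,1)`: `Φ^st(γ, f) = Φ(γ,f) + Φ(γ₁,f) + Φ(γ₂,f)`, here `= ½ Σ_{σ ∈ S₃} ∫ f(g γ_σ g⁻¹) dg`.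
[cite: Rogawski1990, §4.1 (4.1.1) p. 39; §8.2 Prop. 8.2.1 p. 118; §4.9 p. 54] [cite: Folland1995, §2.6 (2.52)] -/
theorem stableOrbitalIntegralRel_circleDiagonal_eq_inv_mul_sum_integral_conj (hα : ∀ i, α i ≠ 0) (hreal : ∀ i, (w.1.embedding (α i)).im = 0)
    {P : archLocal L N (diagonal α) w → Prop} {ν : Measure (archLocal L N (diagonal α) w)} [ν.IsHaarMeasure] [ν.IsMulRightInvariant]
    {m : OrbitalMeasureFamily (archLocal L N (diagonal α) w)} (hm : m.IsCanonical P ν) {z : Fin N → Circle} (hz : Function.Injective z)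
    (hP : ∀ σ : Perm (Fin N),
      P (Quotient.out (ConjClasses.mk (⟨circleDiagonal N (z ∘ σ), circleDiagonal_mem_archLocal_diagonal L N α w (z ∘ σ)⟩ : archLocal L N (diagonal α) w))))
    (a : archLocal L N (diagonal α) w → ℂ) (ha : Continuous a) :
    stableOrbitalIntegralRel (G := archLocal L N (diagonal α) w) (IsStablyConj (starRingEnd ℂ) ((diagonal α).map w.1.embedding)) m a
        ⟨circleDiagonal N z, circleDiagonal_mem_archLocal_diagonal L N α w z⟩ =
      (((Finset.univ.filter fun i => 0 < (w.1.embedding (α i)).re).card.factorial *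
          (N - (Finset.univ.filter fun i => 0 < (w.1.embedding (α i)).re).card).factorial : ℕ) : ℂ)⁻¹ *
        ∑ σ : Perm (Fin N), ∫ g, a (g * ⟨circleDiagonal N (z ∘ σ), circleDiagonal_mem_archLocal_diagonal L N α w (z ∘ σ)⟩ * g⁻¹) ∂ν := by
  rw [stableOrbitalIntegralRel_circleDiagonal_eq_inv_mul_sum_classOrbitalIntegral L N α w hα hreal hz m a]
  congr 1
  exact Finset.sum_congr rfl fun σ _ =>
    classOrbitalIntegral_mk_circleDiagonal_eq_integral_conj L N α w hα hm (hz.comp σ.injective) (hP σ) a ha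

omit [∀ g : archLocal L N (diagonal α) w, MeasurableSpace (archLocal L N (diagonal α) w ⧸ Subgroup.centralizer ({g} : Set (archLocal L N (diagonal α) w)))]
  [LocallyCompactSpace (archLocal L N (diagonal α) w)] [SecondCountableTopology (archLocal L N (diagonal α) w)]
  [MeasurableSpace (archLocal L N (diagonal α) w)] [BorelSpace (archLocal L N (diagonal α) w)]
  [∀ g : archLocal L N (diagonal α) w, BorelSpace (archLocal L N (diagonal α) w ⧸ Subgroup.centralizer ({g} : Set (archLocal L N (diagonal α) w)))] w in
/-- Precomposition with a permutation is continuous on `(S¹)^N`. [cite: BrockerTomDieck1985, Ch. IV (3.1)] -/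
theorem continuous_comp_perm_place (σ : Perm (Fin N)) : Continuous fun z : Fin N → Circle => z ∘ σ :=
  continuous_pi fun i => continuous_apply (σ i)

open scoped Classical in
/-- **CONTINUITY OF `Φ^st_w(diag z, a)` ON THE REGULAR SET, from the continuity of the torus function** `z ↦ ∫_{G_w} a(g · diag z · g⁻¹) dν` on `{z ∣ z injective}` — the latter is
F0P3a-p06 (g9)'s ★ (a5) `continuousOn_integral_comp_conj_circleDiagonal` for `a ∈ C_c(G_w)` (next theorem); kept in hypothesis form `hF` for other function classes: the STABLE
orbital integral is then continuous on `T_reg` too. [cite: Rogawski1990, §8.2 Prop. 8.2.1 p. 118] [cite: Shelstad1979, §4] -/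
theorem continuousOn_stableOrbitalIntegralRel_circleDiagonal_of_continuousOn (hα : ∀ i, α i ≠ 0) (hreal : ∀ i, (w.1.embedding (α i)).im = 0)
    {P : archLocal L N (diagonal α) w → Prop} {ν : Measure (archLocal L N (diagonal α) w)} [ν.IsHaarMeasure] [ν.IsMulRightInvariant]
    {m : OrbitalMeasureFamily (archLocal L N (diagonal α) w)} (hm : m.IsCanonical P ν)
    (hP : ∀ z : Fin N → Circle, Function.Injective z →
      P (Quotient.out (ConjClasses.mk (⟨circleDiagonal N z, circleDiagonal_mem_archLocal_diagonal L N α w z⟩ : archLocal L N (diagonal α) w))))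
    (a : archLocal L N (diagonal α) w → ℂ) (ha : Continuous a)
    (hF : ContinuousOn (fun z : Fin N → Circle => ∫ g, a (g * ⟨circleDiagonal N z, circleDiagonal_mem_archLocal_diagonal L N α w z⟩ * g⁻¹) ∂ν)
      {z | Function.Injective z}) :
    ContinuousOn (fun z : Fin N → Circle =>
      stableOrbitalIntegralRel (G := archLocal L N (diagonal α) w) (IsStablyConj (starRingEnd ℂ) ((diagonal α).map w.1.embedding)) m a
        ⟨circleDiagonal N z, circleDiagonal_mem_archLocal_diagonal L N α w z⟩) {z | Function.Injective z} := by
  have heq : Set.EqOn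
      (fun z : Fin N → Circle =>
        stableOrbitalIntegralRel (G := archLocal L N (diagonal α) w) (IsStablyConj (starRingEnd ℂ) ((diagonal α).map w.1.embedding)) m a
          ⟨circleDiagonal N z, circleDiagonal_mem_archLocal_diagonal L N α w z⟩)
      (fun z => (((Finset.univ.filter fun i => 0 < (w.1.embedding (α i)).re).card.factorial *
          (N - (Finset.univ.filter fun i => 0 < (w.1.embedding (α i)).re).card).factorial : ℕ) : ℂ)⁻¹ *
        ∑ σ : Perm (Fin N), ∫ g, a (g * ⟨circleDiagonal N (z ∘ σ), circleDiagonal_mem_archLocal_diagonal L N α w (z ∘ σ)⟩ * g⁻¹) ∂ν)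
      {z | Function.Injective z} :=
    fun z hz => stableOrbitalIntegralRel_circleDiagonal_eq_inv_mul_sum_integral_conj L N α w hα hreal hm hz (fun σ => hP _ (hz.comp σ.injective)) a ha
  refine ContinuousOn.congr ?_ heq
  refine continuousOn_const.mul (continuousOn_finsetSum _ fun σ _ => ?_)
  exact hF.comp (continuous_comp_perm_place N σ).continuousOn fun z hz => (show Function.Injective z from hz).comp σ.injective

/-- **`Φ^st_w(diag z, a)` IS CONTINUOUS ON THE REGULAR TORUS `T_reg = {z ∣ z injective}`** for `a ∈ C_c(G_w)` and a family `m` canonical for `(P, ν)` on the regular torus classes — in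
`G_w = U(σ_w diag α)(ℂ)` of ANY signature: the previous theorem with `hF` := ★ (a5) `continuousOn_integral_comp_conj_circleDiagonal` (F0P3a-p06, p839258).  The (L-cont) input for the
STABLE orbital integral («`Φ^st(γ, f)` is continuous on `T_reg`»). [cite: Rogawski1990, §8.2 Prop. 8.2.1 p. 118] [cite: Shelstad1979, §4] -/
theorem continuousOn_stableOrbitalIntegralRel_circleDiagonal (hα : ∀ i, α i ≠ 0) (hreal : ∀ i, (w.1.embedding (α i)).im = 0)
    {P : archLocal L N (diagonal α) w → Prop} {ν : Measure (archLocal L N (diagonal α) w)} [ν.IsHaarMeasure] [ν.IsMulRightInvariant]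
    {m : OrbitalMeasureFamily (archLocal L N (diagonal α) w)} (hm : m.IsCanonical P ν)
    (hP : ∀ z : Fin N → Circle, Function.Injective z →
      P (Quotient.out (ConjClasses.mk (⟨circleDiagonal N z, circleDiagonal_mem_archLocal_diagonal L N α w z⟩ : archLocal L N (diagonal α) w))))
    (a : archLocal L N (diagonal α) w → ℂ) (ha : Continuous a) (hac : HasCompactSupport a) :
    ContinuousOn (fun z : Fin N → Circle =>
      stableOrbitalIntegralRel (G := archLocal L N (diagonal α) w) (IsStablyConj (starRingEnd ℂ) ((diagonal α).map w.1.embedding)) m a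
        ⟨circleDiagonal N z, circleDiagonal_mem_archLocal_diagonal L N α w z⟩) {z | Function.Injective z} :=
  continuousOn_stableOrbitalIntegralRel_circleDiagonal_of_continuousOn L N α w hα hreal hm hP a ha
    (continuousOn_integral_comp_conj_circleDiagonal L N α w hα ν a ha hac)

end Place

end UnitaryGroup

end Literature.NumberTheory.Automorphic

end
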